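import Summits.Ventures.HSemireg.WedgeHankelRecurrenceKronecker
import Literature.FieldTheory.FiniteFields.LinearRecurrenceMinimalPolynomial

/-!
# Venture HSemireg — THE BRIDGE BETWEEN THE LINEAGE'S WINDOW THEORY AND THE LITERATURE'S LINEARLY RECURRENT SEQUENCES: the Hankel functional `⟪f, q⟫_s` of N18 IS the shift action
# `(f • q)_s = polySMul f q s` of `Literature/LinearAlgebra/Matrix/WiedemannAlgorithm` (von zur Gathen–Gerhard §12.3); the middle catalecticant `H^N_{⌊N/2⌋}(q)` IS the Hankel section
# `(q_{0+i+j})` of `Literature/LinearAlgebra/Matrix/HankelRecurrenceRank` (Gantmacher XV §10); hence **bounded middle ranks `⟺ IsLinRec K q`**, **`R^N(q) = deg minpolySeq K q` for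
# `2 deg ≤ N + 1`** (Gantmacher's Theorem 7 read on the lineage's windows), **`(∀ s, ⟪f, q⟫_s = 0) ⟺ minpolySeq K q ∣ f`** (Lidl–Niederreiter Thm. 8.42), **the denominator of a REDUCED symbol
# `a/m` is the minimal polynomial: `minpolySeq K (dualSeq m a) = m`**, and the periodicity theorems of Lidl–Niederreiter Ch. 8 (8.7, 8.44) TRANSPORT to bounded-rank sequences
# («the lineage's "linear complexity = lim R^N" is the degree of the Literature's minimal polynomial; nothing of Ch. 8 is re-proved here»)

HONEST FRAMING. Part of the Lean index of the computation cell `pub-hsemireg` (seat p10 gen 31, Sunday typer «UNIFORM-IN-n»).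
LINEAR ALGEBRA OF HANKEL (catalecticant) MATRICES and of polynomials over a field ONLY: no variety, no cohomology theory, no sheaf, no Ext group and no semiregularity map is constructed here;
nothing here says that HC / HC_CM / HC_AV holds.  No unproved named fact is used: the PROVED Literature modules `Literature.LinearAlgebra.Matrix.WiedemannAlgorithm` (`polySMul`, `IsCharPoly`,
`IsLinRec`, `seqAnn`, `minpolySeq`, `minpolySeq_dvd_iff`, `monic_minpolySeq`), `Literature.LinearAlgebra.Matrix.HankelRecurrenceRank` (Gantmacher Thm. 7: `rank_hankel_eq_natDegree_minpolySeq`,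
`isLinRec_iff_exists_rank_hankel_le`) and `Literature.FieldTheory.FiniteFields.LinearRecurrenceMinimalPolynomial` (Lidl–Niederreiter Thm. 8.42 ∕ 8.44: `exists_minpolySeq_eq_X_pow_mul`,
`eventually_periodic_iff_polOrd_dvd`, `isLeast_eventual_period`) are imported and this file is the DICTIONARY — nothing of them is restated.  Custodian versions as in `WedgeHankelSiegelIdeal` (1/3).

WHAT IS IN THE TREE ∕ LINEAGE.  N97 (`WedgeHankelRecurrenceKronecker`): `forall_rank_half_le_iff_exists_recurrence` (bounded `R^N` ⟺ one monic recurrence at every shift, proved from the window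
structure theory), `rank_half_dualSeq_le_natDegree`; N32: `mem_recSpace_dualSeq_iff`, `mem_recSpace_dualSeq`; N18: `hankel1`, `hkFun`, `hkFun_eq_sum_range`, `mem_recSpace_iff`, `mem_degreeLT_succ_iff`.
THIS FILE (namespace `Summit.Ventures.HSemireg.Wedge.HankelOuter` continued; CHAINED on N97 (+ those Literature modules); 0 definitions):
* §655 IDENTIFICATIONS: `hankel1_eq_section` (`H^N_k(q) = (q_{0+i+j})_{i ≤ k, j ≤ N−k}`), **`hkFun_eq_polySMul`** (`⟪f, q⟫_s = (f • q)_s`), `forall_hkFun_eq_zero_iff_polySMul_eq_zero`,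
  **`forall_hkFun_eq_zero_iff_minpolySeq_dvd`** (Thm. 8.42 in the lineage's language); RANKS: **`exists_forall_rank_half_le_iff_isLinRec`**, **`forall_rank_half_le_iff_natDegree_minpolySeq_le`**
  (`R^N(q) ≤ d ∀ N ⟺ IsLinRec K q ∧ deg m_q ≤ d`), **`rank_half_eq_natDegree_minpolySeq`** (`R^N(q) = deg m_q` as soon as `2 deg m_q ≤ N + 1` — Gantmacher Thm. 7 transported: THE LINEAR COMPLEXITY
  PROFILE IS CONSTANT FROM `N = 2 deg m_q − 1` ON); SYMBOLS: **`minpolySeq_dualSeq`** (reduced `a/m`: `minpolySeq K (dualSeq m a) = m`); TRANSPORTED PERIODICITY (finite field, Lidl–Niederreiter 8.44):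
  `eventually_periodic_of_forall_rank_half_le` (bounded ranks ⇒ ultimately periodic with a positive period), `exists_isLeast_eventual_period_of_forall_rank_half_le` (bounded ranks ⇒
  `m_q = X^h g` with `g(0) ≠ 0` and least eventual period `ord(g)`).
Nothing Ext-side.  New names only.
-/

open Module Polynomial
open scoped Matrix Polynomial

namespace Summit.Ventures.HSemireg.Wedge.HankelOuter

open Summit.Ventures.HSemireg.Wedge Summit.Ventures.HSemireg.Wedge.Hankel
open Literature.LinearAlgebra.Matrix.WiedemannAlgorithm
open Literature.LinearAlgebra.Matrix.HankelRecurrenceRank (rank_hankel_eq_natDegree_minpolySeq)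
open Literature.FieldTheory.FiniteFields.LinearRecurrenceMinimalPolynomial (exists_minpolySeq_eq_X_pow_mul eventually_periodic_iff_polOrd_dvd isLeast_eventual_period)
open Literature.Algebra.Polynomial.OrderOfPolynomial (polOrd polOrd_pos)

variable (K : Type*) [Field K]

/-! ## §655. Window theory ⟷ Literature's linearly recurrent sequences -/

omit [Field K] in
/-- the lineage's catalecticant `H^N_k(q)` is the Literature's Hankel section `(q_{0+i+j})` with `k + 1` rows and `N + 1 − k` columns. -/
theorem hankel1_eq_section (N k : ℕ) (q : ℕ → K) : hankel1 K N k q = Matrix.of fun (i : Fin (k + 1)) (j : Fin (N + 1 - k)) => q (0 + (i : ℕ) + (j : ℕ)) := by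
  ext i j
  simp only [hankel1, Matrix.of_apply, zero_add]

/-- **`⟪f, q⟫_s = (f • q)_s`**: the Hankel functional of N18 is the shift action `polySMul` of the Literature (von zur Gathen–Gerhard §12.3). -/
theorem hkFun_eq_polySMul (q : ℕ → K) (s : ℕ) (f : K[X]) : hkFun K q s f = polySMul f q s := by
  rw [hkFun_eq_sum_range K q s (Nat.lt_succ_self f.natDegree), polySMul_apply]
  exact Finset.sum_congr rfl fun i _ => by rw [smul_eq_mul, add_comm s i]

/-- `⟪f, q⟫_s = 0` for every shift `s` iff `f • q = 0`. -/
theorem forall_hkFun_eq_zero_iff_polySMul_eq_zero (q : ℕ → K) (f : K[X]) : (∀ s, hkFun K q s f = 0) ↔ polySMul f q = 0 := by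
  simp only [hkFun_eq_polySMul, funext_iff, Pi.zero_apply]

/-- **LIDL–NIEDERREITER THM. 8.42 IN THE LINEAGE'S LANGUAGE: `⟪f, q⟫_s = 0` for every shift `s` iff the Literature's minimal polynomial `minpolySeq K q` divides `f`.** -/
theorem forall_hkFun_eq_zero_iff_minpolySeq_dvd (q : ℕ → K) (f : K[X]) : (∀ s, hkFun K q s f = 0) ↔ minpolySeq K q ∣ f := by
  rw [forall_hkFun_eq_zero_iff_polySMul_eq_zero, minpolySeq_dvd_iff]

/-- **BOUNDED MIDDLE RANKS ⟺ LINEARLY RECURRENT (`IsLinRec` of the Literature).** (⇒) N97 gives a monic recurrence at every shift, i.e. a characteristic polynomial; (⇐) a characteristic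
polynomial normalised to monic is a recurrence at every shift, and N97's easy direction bounds `R^N`. -/
theorem exists_forall_rank_half_le_iff_isLinRec (q : ℕ → K) : (∃ d, ∀ N, (hankel1 K N (N / 2) q).rank ≤ d) ↔ IsLinRec K q := by
  constructor
  · rintro ⟨d, hd⟩
    obtain ⟨m, hmo, -, hrec⟩ := (forall_rank_half_le_iff_exists_recurrence K q d).mp hd
    exact ⟨m, hmo.ne_zero, (forall_hkFun_eq_zero_iff_polySMul_eq_zero K q m).mp hrec⟩
  · intro ha
    refine ⟨(minpolySeq K q).natDegree, (forall_rank_half_le_iff_exists_recurrence K q _).mpr ⟨minpolySeq K q, monic_minpolySeq ha, le_rfl, ?_⟩⟩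
    exact (forall_hkFun_eq_zero_iff_minpolySeq_dvd K q _).mpr dvd_rfl

/-- **`R^N(q) ≤ d` for all `N` iff `q` is linearly recurrent with `deg minpolySeq K q ≤ d`** (the minimal polynomial divides every recurrence valid at every shift). -/
theorem forall_rank_half_le_iff_natDegree_minpolySeq_le (q : ℕ → K) (d : ℕ) :
    (∀ N, (hankel1 K N (N / 2) q).rank ≤ d) ↔ IsLinRec K q ∧ (minpolySeq K q).natDegree ≤ d := by
  constructor
  · intro hd
    have ha : IsLinRec K q := (exists_forall_rank_half_le_iff_isLinRec K q).mp ⟨d, hd⟩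
    obtain ⟨m, hmo, hmd, hrec⟩ := (forall_rank_half_le_iff_exists_recurrence K q d).mp hd
    exact ⟨ha, (Polynomial.natDegree_le_of_dvd ((forall_hkFun_eq_zero_iff_minpolySeq_dvd K q m).mp hrec) hmo.ne_zero).trans hmd⟩
  · rintro ⟨ha, hdeg⟩
    exact (forall_rank_half_le_iff_exists_recurrence K q d).mpr ⟨minpolySeq K q, monic_minpolySeq ha, hdeg, (forall_hkFun_eq_zero_iff_minpolySeq_dvd K q _).mpr dvd_rfl⟩

/-- **GANTMACHER'S THEOREM 7 ON THE LINEAGE'S WINDOWS: `R^N(q) = deg minpolySeq K q` as soon as `2 deg ≤ N + 1`** — the middle-rank profile of a linearly recurrent sequence is constant from the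
level `2 deg m_q − 1` on, and its value is the LINEAR COMPLEXITY (Literature `rank_hankel_eq_natDegree_minpolySeq` on the section with `⌊N/2⌋ + 1` rows and `N + 1 − ⌊N/2⌋` columns). -/
theorem rank_half_eq_natDegree_minpolySeq {q : ℕ → K} (ha : IsLinRec K q) {N : ℕ} (hN : (minpolySeq K q).natDegree + (minpolySeq K q).natDegree ≤ N + 1) :
    (hankel1 K N (N / 2) q).rank = (minpolySeq K q).natDegree := by
  rw [hankel1_eq_section]
  have h := rank_hankel_eq_natDegree_minpolySeq ha (p := N / 2 + 1) (q := N + 1 - N / 2) (by omega) (by omega)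
  simpa only [zero_add] using h

/-- **THE DENOMINATOR OF A REDUCED SYMBOL IS THE MINIMAL POLYNOMIAL: `minpolySeq K (dualSeq m a) = m`** for `m` monic and `gcd(m, a) = 1` (`m` annihilates the dual class, N32; a polynomial
annihilating it at every shift lies in a window where N32 forces `m ∣ f·a`, hence `m ∣ f`). -/
theorem minpolySeq_dualSeq {m a : K[X]} (hm : m.Monic) (hcop : IsCoprime m a) : minpolySeq K (dualSeq K m a) = m := by
  refine (eq_minpolySeq hm fun f => ?_).symm
  rw [← forall_hkFun_eq_zero_iff_polySMul_eq_zero]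
  constructor
  · rintro ⟨c, rfl⟩ s
    have hmem : m * c ∈ recSpace K (s + (m * c).natDegree) (dualSeq K m a) (m * c).natDegree :=
      mem_recSpace_dualSeq_of_dvd K hm a ((mem_degreeLT_succ_iff K).mpr le_rfl) (dvd_mul_of_dvd_left (dvd_mul_right m c) a)
    exact ((mem_recSpace_iff K).mp hmem).2 s le_rfl
  · intro h
    have hmem : f ∈ recSpace K (f.natDegree + m.natDegree) (dualSeq K m a) f.natDegree := (mem_recSpace_iff K).mpr ⟨(mem_degreeLT_succ_iff K).mpr le_rfl, fun s _ => h s⟩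
    exact hcop.dvd_of_dvd_mul_right ((mem_recSpace_dualSeq_iff K hm a (by omega) f).mp hmem).2

/-- **TRANSPORTED (Lidl–Niederreiter Thm. 8.44 ∕ 8.7): over a FINITE field a sequence with bounded middle ranks is ULTIMATELY PERIODIC with a positive period** (`ord(g)` for `m_q = X^h g`,
`g(0) ≠ 0`). -/
theorem eventually_periodic_of_forall_rank_half_le [Finite K] {q : ℕ → K} {d : ℕ} (hd : ∀ N, (hankel1 K N (N / 2) q).rank ≤ d) : ∃ r, 0 < r ∧ ∃ n₀, ∀ n, n₀ ≤ n → q (n + r) = q n := by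
  have ha : IsLinRec K q := (exists_forall_rank_half_le_iff_isLinRec K q).mp ⟨d, hd⟩
  obtain ⟨h, g, hm, hg⟩ := exists_minpolySeq_eq_X_pow_mul ha
  exact ⟨polOrd g, polOrd_pos hg, (eventually_periodic_iff_polOrd_dvd hm hg _).mpr dvd_rfl⟩

/-- **TRANSPORTED (Lidl–Niederreiter Thm. 8.44): a bounded-rank sequence over a finite field has a minimal polynomial `X^h · g` with `g(0) ≠ 0`, and its least eventual period is `ord(g)`**
(Literature `exists_minpolySeq_eq_X_pow_mul` + `isLeast_eventual_period`, reached through `IsLinRec` from the bounded ranks). -/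
theorem exists_isLeast_eventual_period_of_forall_rank_half_le [Finite K] {q : ℕ → K} {d : ℕ} (hd : ∀ N, (hankel1 K N (N / 2) q).rank ≤ d) :
    ∃ (h : ℕ) (g : K[X]), minpolySeq K q = Polynomial.X ^ h * g ∧ g.coeff 0 ≠ 0 ∧ IsLeast {r : ℕ | 0 < r ∧ ∃ n₀, ∀ n, n₀ ≤ n → q (n + r) = q n} (polOrd g) := by
  obtain ⟨h, g, hm, hg⟩ := exists_minpolySeq_eq_X_pow_mul ((exists_forall_rank_half_le_iff_isLinRec K q).mp ⟨d, hd⟩)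
  exact ⟨h, g, hm, hg, isLeast_eventual_period hm hg⟩

end Summit.Ventures.HSemireg.Wedge.HankelOuter
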